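import Mathlib
import HarnessLib
import Summits.ABC.ABC.Statement
import Literature.NumberTheory.DiophantineApproximation.Beukers1981SquaresNearPowersOfTwo

/-!
# The square pencil `2^l + q = r²` of the `ω = 3` atlas: what is KNOWN (Beukers 1981, effective)

`Summits/ABC/ABC/Theorems/SoloBlindSquarePencilKnown.lean`; namespace `Summit.ABC.ABC.Theorems`
(solo seat `solo-ABC-blind`, wall coordinate T52; companion of `SoloBlindOmega3Known` (T50), which bounds
`log c` on the whole `ω(abc) = 3` locus `(abc).primeFactors = {2, p, q}` by the two-logarithm engines).

THE PENCIL.  Inside `ω(abc) = 3` sits the two-parameter family of abc triples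
`(a, b, c) = (2^l, q, r²)`, i.e. `2^l + q = r²` with `q` odd (`q`, `r` squarefree in the radical
statements; in the atlas `q`, `r` are odd primes).  Writing `l = 2j + 1`, a member is a rational
`r/2^j` close to `√2`: `0 < r/2^j − √2 = q/(2^j (r + 2^j √2))`, so on this pencil
* abc says `c = r² ≪_δ q^{2+δ}` for every `δ > 0` (⟸ is `squarePencil_abc_of_depth` below; it is the
  restricted irrationality measure `1 + δ` for `√2` against `2`-power denominators, a case of RIDOUT's
  theorem (1957/58) — true, ineffective; the tree proves Ridout only for the archimedean target `0`,
  `Literature/NumberTheory/DiophantineApproximation/RidoutRationalsZero.lean`);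
* trivially `c = r² < rad(abc)²` (`squarePencil_sq_lt_rad_sq`: `rad = 2·q·r ≥ 2r`);
* linear forms in two logarithms are VOID here (the exponent of the varying prime `q` is `1`, so the
  Laurent/Bugeaud–Laurent bounds of T50 are worse than the Liouville bound `|r² − 2^l| ≥ 1`);
* the hypergeometric method (Beukers 1981: Padé approximants to `(1 − z)^{1/2}`) gives the EFFECTIVE
  measure behind `n < 433 + 10 log₂ D` for `x² − D = 2^{n+2}` — the named fact
  `Literature.NumberTheory.DiophantineApproximation.beukers1981_dyadic` (Le 1992, Lemma 23).

THIS FILE (everything PROVED, the Beukers statements modulo the named fact `h : beukers1981_dyadic`):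
* `squarePencil_isABCTriple` — `(2^l, q, r²)` is an abc triple for `q` odd;
* `squarePencil_two_mul_dvd_rad`, `squarePencil_sq_lt_rad_sq` — `2qr ∣ rad`, hence `c < rad²` (`l ≥ 1`,
  `q`, `r` squarefree);
* `squarePencil_exponent_lt` — `l < 435 + 10 log q / log 2` (`l ≥ 3`);
* `squarePencil_two_pow_lt`, `squarePencil_c_lt`, `squarePencil_r_lt` — `2^l < 2^{435} q^{10}`,
  `c = r² < 2^{436} q^{10}`, `r < 2^{218} q^5` (all `l`);
* `squarePencil_c_lt_small` — `q < 2^{96} ⇒ c < 2^{19} q²` (Beukers' second bound: the conjectured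
  exponent `2`, in a finite range);
* `squarePencil_c_cube_lt_rad_pow`, `squarePencil_c_lt_rad_rpow` — against the radical:
  `c³ < 2^{213} rad⁵`, i.e. `c < 2^{71} · rad^{5/3}` — an EFFECTIVE polynomial abc bound with exponent
  `5/3 < 2` on the pencil (abc asks for `1 + ε`; Bauer–Bennett 2002's measure `1.48` would give
  `≈ 1.32`, not vendored);
* `squarePencil_abc_of_depth` — the dictionary: a depth bound `c ≪_δ q^{2+δ}` (all `δ > 0`) implies abc
  on the pencil (`ε = δ/2`, constant `√C`).

READING for the wall.  On this pencil the effective frontier is an EXPONENT (`5/3`, resp. `≈ 1.32`),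
not a constant: the Padé data for `√2` have quality `log E/log Q` bounded away from the value that
would give measure `1 + ε`, and no known construction improves with the height; the ineffective
theorem (Ridout) already gives abc here but no constant.  Both engines see ONE fixed algebraic number
and ONE varying prime power; neither couples two varying prime powers (cf. T30, T50, T51).
-/

namespace Summit.ABC.ABC.Theorems

open Real UniqueFactorizationMonoid Literature.NumberTheory.DiophantineApproximation
  Literature.NumberTheory.DiophantineGeometry

set_option exponentiation.threshold 1024

/-! ## The pencil and its radical -/

/-- `(2^l, q, r²)` with `q` odd and `2^l + q = r²` is an abc triple. [folklore] -/
theorem squarePencil_isABCTriple {l q r : ℕ} (hq : Odd q) (he : 2 ^ l + q = r ^ 2) :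
    IsABCTriple (2 ^ l) q (r ^ 2) :=
  ⟨by positivity, hq.pos, he, Nat.Coprime.pow_left l (Nat.coprime_two_left.mpr hq)⟩

/-- On the pencil with `l ≥ 1`, `r` is odd. [folklore] -/
theorem squarePencil_odd_r {l q r : ℕ} (hl : 1 ≤ l) (hq : Odd q) (he : 2 ^ l + q = r ^ 2) : Odd r := by
  have h2 : Even (2 ^ l) := (Nat.even_pow' (by omega)).mpr (by decide)
  have : Odd (r ^ 2) := by rw [← he]; exact h2.add_odd hq
  exact (Nat.odd_pow_iff two_ne_zero).mp this

/-- On the pencil, `q` and `r` are coprime (a common divisor divides `2^l` and is odd). [folklore] -/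
theorem squarePencil_coprime_q_r {l q r : ℕ} (hq : Odd q) (he : 2 ^ l + q = r ^ 2) :
    Nat.Coprime q r := by
  have h2 : Nat.Coprime q (2 ^ l) := (Nat.Coprime.pow_left l (Nat.coprime_two_left.mpr hq)).symm
  have h3 : Nat.Coprime q (r ^ 2) := by
    rw [← he]
    exact Nat.coprime_add_self_right.mpr h2
  exact (Nat.coprime_pow_right_iff (by norm_num) _ _).mp h3

/-- `2·q·r` divides `rad(2^l · q · r²)` when `l ≥ 1` and `q`, `r` are squarefree (then `2qr` is squarefree,
hence radical, and divides `2^l q r²`). [folklore] -/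
theorem squarePencil_two_mul_dvd_rad {l q r : ℕ} (hl : 1 ≤ l) (hq : Odd q) (hsq : Squarefree q)
    (hsr : Squarefree r) (he : 2 ^ l + q = r ^ 2) : 2 * q * r ∣ rad (2 ^ l) q (r ^ 2) := by
  have hr : Odd r := squarePencil_odd_r hl hq he
  have hqr : Nat.Coprime q r := squarePencil_coprime_q_r hq he
  have hsf : Squarefree (2 * q * r) := by
    rw [Nat.squarefree_mul_iff, Nat.squarefree_mul_iff]
    refine ⟨?_, ⟨Nat.coprime_two_left.mpr hq, Nat.squarefree_two, hsq⟩, hsr⟩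
    exact Nat.coprime_mul_iff_left.mpr ⟨Nat.coprime_two_left.mpr hr, hqr⟩
  rw [rad_def]
  have hne : 2 ^ l * q * r ^ 2 ≠ 0 :=
    mul_ne_zero (mul_ne_zero (pow_ne_zero _ two_ne_zero) hq.pos.ne') (pow_ne_zero _ hr.pos.ne')
  rw [dvd_radical_iff hsf.isRadical hne]
  exact ⟨2 ^ (l - 1) * r, by
    rw [show 2 ^ l = 2 * 2 ^ (l - 1) by rw [← pow_succ']; congr 1; omega]; ring⟩

/-- `2·q·r ≤ rad(2^l · q · r²)` under the same hypotheses. [folklore] -/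
theorem squarePencil_two_mul_le_rad {l q r : ℕ} (hl : 1 ≤ l) (hq : Odd q) (hsq : Squarefree q)
    (hsr : Squarefree r) (he : 2 ^ l + q = r ^ 2) : 2 * q * r ≤ rad (2 ^ l) q (r ^ 2) :=
  Nat.le_of_dvd (by rw [rad_def]; exact Nat.radical_pos _)
    (squarePencil_two_mul_dvd_rad hl hq hsq hsr he)

/-- **The trivial bound on the pencil**: `c = r² < rad(abc)²` (indeed `rad ≥ 2qr ≥ 2r`). [folklore] -/
theorem squarePencil_sq_lt_rad_sq {l q r : ℕ} (hl : 1 ≤ l) (hq : Odd q) (hsq : Squarefree q)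
    (hsr : Squarefree r) (he : 2 ^ l + q = r ^ 2) : r ^ 2 < rad (2 ^ l) q (r ^ 2) ^ 2 := by
  have hrad := squarePencil_two_mul_le_rad hl hq hsq hsr he
  have hq1 : 1 ≤ q := hq.pos
  have hr1 : 1 ≤ r := by
    rcases Nat.eq_zero_or_pos r with h | h
    · subst h; simp at he
    · exact h
  calc r ^ 2 < (2 * q * r) ^ 2 := by
        apply Nat.pow_lt_pow_left _ two_ne_zero
        nlinarith
    _ ≤ rad (2 ^ l) q (r ^ 2) ^ 2 := Nat.pow_le_pow_left hrad 2

/-! ## Beukers' bounds on the pencil -/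

/-- **Exponent bound** (Beukers 1981 via [Le1992] Lemma 23): `2^l + q = r²`, `q` odd, `l ≥ 3` ⇒
`l < 435 + 10 log q / log 2`. [cite: Le1992, Lemma 23] -/
theorem squarePencil_exponent_lt (h : beukers1981_dyadic) {l q r : ℕ} (hq : Odd q) (hl : 3 ≤ l)
    (he : 2 ^ l + q = r ^ 2) : (l : ℝ) < 435 + 10 * Real.log q / Real.log 2 := by
  have hr : 0 < r := by
    rcases Nat.eq_zero_or_pos r with h0 | h0
    · subst h0; simp at he
    · exact h0
  obtain ⟨n, rfl⟩ : ∃ n, l = n + 2 := ⟨l - 2, by omega⟩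
  have hn : 0 < n := by omega
  have hb := (h q r n hq hr hn (by omega)).1
  push_cast
  linarith

/-- **`2^l < 2^{435} q^{10}`** on the pencil (all `l`; for `l ≤ 2` trivially). [cite: Le1992, Lemma 23] -/
theorem squarePencil_two_pow_lt (h : beukers1981_dyadic) {l q r : ℕ} (hq : Odd q)
    (he : 2 ^ l + q = r ^ 2) : 2 ^ l < 2 ^ 435 * q ^ 10 := by
  have hq1 : 1 ≤ q := hq.pos
  by_cases hl : 3 ≤ l
  · have hr : 0 < r := by
      rcases Nat.eq_zero_or_pos r with h0 | h0
      · subst h0; simp at he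
      · exact h0
    obtain ⟨n, rfl⟩ : ∃ n, l = n + 2 := ⟨l - 2, by omega⟩
    have hn : 0 < n := by omega
    have := two_pow_lt_of_beukers1981 h hq hr hn (by omega : r ^ 2 = q + 2 ^ (n + 2))
    exact_mod_cast this
  · have h1 : 2 ^ l ≤ 2 ^ 2 := Nat.pow_le_pow_right (by norm_num) (by omega)
    have h2 : 1 ≤ q ^ 10 := Nat.one_le_pow _ _ hq1
    calc 2 ^ l ≤ 2 ^ 2 := h1
      _ < 2 ^ 435 := Nat.pow_lt_pow_right (by norm_num) (by norm_num)
      _ = 2 ^ 435 * 1 := (mul_one _).symm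
      _ ≤ 2 ^ 435 * q ^ 10 := Nat.mul_le_mul_left _ h2

/-- **`c = r² < 2^{436} q^{10}`** on the pencil. [cite: Le1992, Lemma 23] -/
theorem squarePencil_c_lt (h : beukers1981_dyadic) {l q r : ℕ} (hq : Odd q)
    (he : 2 ^ l + q = r ^ 2) : r ^ 2 < 2 ^ 436 * q ^ 10 := by
  have h1 := squarePencil_two_pow_lt h hq he
  have hq1 : 1 ≤ q := hq.pos
  have h2 : q ≤ 2 ^ 435 * q ^ 10 := by
    calc q = 1 * q ^ 1 := by ring
      _ ≤ 2 ^ 435 * q ^ 10 := Nat.mul_le_mul Nat.one_le_two_pow (Nat.pow_le_pow_right hq1 (by norm_num))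
  calc r ^ 2 = 2 ^ l + q := he.symm
    _ < 2 ^ 435 * q ^ 10 + 2 ^ 435 * q ^ 10 := by omega
    _ = 2 ^ 436 * q ^ 10 := by ring

/-- **`r < 2^{218} q^{5}`** on the pencil (square root of the previous bound). [cite: Le1992, Lemma 23] -/
theorem squarePencil_r_lt (h : beukers1981_dyadic) {l q r : ℕ} (hq : Odd q)
    (he : 2 ^ l + q = r ^ 2) : r < 2 ^ 218 * q ^ 5 := by
  have h1 := squarePencil_c_lt h hq he
  have : r ^ 2 < (2 ^ 218 * q ^ 5) ^ 2 := by
    calc r ^ 2 < 2 ^ 436 * q ^ 10 := h1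
      _ = 2 ^ (218 * 2) * q ^ (5 * 2) := by norm_num
      _ = (2 ^ 218 * q ^ 5) ^ 2 := by rw [pow_mul, pow_mul, ← mul_pow]
  exact (Nat.pow_lt_pow_iff_left two_ne_zero).mp this

/-- **Small range** (Beukers' second bound): `q < 2^{96}` ⇒ `c = r² < 2^{19} q²` — the conjectured
exponent `2`, in a finite range. [cite: Le1992, Lemma 23] -/
theorem squarePencil_c_lt_small (h : beukers1981_dyadic) {l q r : ℕ} (hq : Odd q)
    (he : 2 ^ l + q = r ^ 2) (hsmall : q < 2 ^ 96) : r ^ 2 < 2 ^ 19 * q ^ 2 := by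
  have hq1 : 1 ≤ q := hq.pos
  have hpow : 2 ^ l < 2 ^ 18 * q ^ 2 := by
    by_cases hl : 3 ≤ l
    · have hr : 0 < r := by
        rcases Nat.eq_zero_or_pos r with h0 | h0
        · subst h0; simp at he
        · exact h0
      obtain ⟨n, rfl⟩ : ∃ n, l = n + 2 := ⟨l - 2, by omega⟩
      have hn : 0 < n := by omega
      have hs : (q : ℝ) < 2 ^ 96 := by exact_mod_cast hsmall
      have := two_pow_lt_of_beukers1981_small h hq hr hn (by omega : r ^ 2 = q + 2 ^ (n + 2)) hs
      exact_mod_cast this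
    · have h1 : 2 ^ l ≤ 2 ^ 2 := Nat.pow_le_pow_right (by norm_num) (by omega)
      have h2 : 1 ≤ q ^ 2 := Nat.one_le_pow _ _ hq1
      calc 2 ^ l ≤ 2 ^ 2 := h1
        _ < 2 ^ 18 * 1 := by norm_num
        _ ≤ 2 ^ 18 * q ^ 2 := Nat.mul_le_mul_left _ h2
  have h2 : q ≤ 2 ^ 18 * q ^ 2 := by
    calc q = 1 * q ^ 1 := by ring
      _ ≤ 2 ^ 18 * q ^ 2 := Nat.mul_le_mul Nat.one_le_two_pow (Nat.pow_le_pow_right hq1 (by norm_num))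
  calc r ^ 2 = 2 ^ l + q := he.symm
    _ < 2 ^ 18 * q ^ 2 + 2 ^ 18 * q ^ 2 := by omega
    _ = 2 ^ 19 * q ^ 2 := by ring

/-! ## Against the radical: an effective exponent `5/3` -/

/-- **`c³ < 2^{213} · rad(abc)⁵`** on the pencil (`l ≥ 1`, `q`, `r` squarefree): from `r < 2^{218} q⁵` and
`2qr ≤ rad`, `c³ = r⁶ = r · r⁵ < 2^{218} q⁵ r⁵ = 2^{213} (2qr)⁵ ≤ 2^{213} rad⁵`. [cite: Le1992, Lemma 23] -/
theorem squarePencil_c_cube_lt_rad_pow (h : beukers1981_dyadic) {l q r : ℕ} (hl : 1 ≤ l) (hq : Odd q)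
    (hsq : Squarefree q) (hsr : Squarefree r) (he : 2 ^ l + q = r ^ 2) :
    (r ^ 2) ^ 3 < 2 ^ 213 * rad (2 ^ l) q (r ^ 2) ^ 5 := by
  have hr := squarePencil_r_lt h hq he
  have hrad := squarePencil_two_mul_le_rad hl hq hsq hsr he
  have hr1 : 0 < r := by
    rcases Nat.eq_zero_or_pos r with h0 | h0
    · subst h0; simp at he
    · exact h0
  calc (r ^ 2) ^ 3 = r ^ 5 * r := by ring
    _ < r ^ 5 * (2 ^ 218 * q ^ 5) := by gcongr
    _ = 2 ^ 213 * (2 * q * r) ^ 5 := by ring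
    _ ≤ 2 ^ 213 * rad (2 ^ l) q (r ^ 2) ^ 5 := by gcongr

/-- **Effective polynomial abc with exponent `5/3` on the square pencil**: `c < 2^{71} · rad(abc)^{5/3}`
(`l ≥ 1`, `q` odd squarefree, `r` squarefree, `2^l + q = r²`). [cite: Le1992, Lemma 23] -/
theorem squarePencil_c_lt_rad_rpow (h : beukers1981_dyadic) {l q r : ℕ} (hl : 1 ≤ l) (hq : Odd q)
    (hsq : Squarefree q) (hsr : Squarefree r) (he : 2 ^ l + q = r ^ 2) :
    (r : ℝ) ^ 2 < 2 ^ 71 * ((rad (2 ^ l) q (r ^ 2) : ℕ) : ℝ) ^ ((5 : ℝ) / 3) := by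
  have hcube := squarePencil_c_cube_lt_rad_pow h hl hq hsq hsr he
  obtain ⟨K, hK⟩ : ∃ K : ℕ, K = 2 ^ 213 := ⟨_, rfl⟩
  rw [← hK] at hcube
  have hKR : (K : ℝ) = 2 ^ 213 := by rw [hK]; norm_num
  have hcubeR : (((r ^ 2) ^ 3 : ℕ) : ℝ) < ((K * rad (2 ^ l) q (r ^ 2) ^ 5 : ℕ) : ℝ) := by
    exact_mod_cast hcube
  push_cast at hcubeR
  rw [hKR] at hcubeR
  generalize hR : ((rad (2 ^ l) q (r ^ 2) : ℕ) : ℝ) = R at hcubeR ⊢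
  have hR0 : 0 ≤ R := by rw [← hR]; exact Nat.cast_nonneg _
  by_contra hle
  rw [not_lt] at hle
  have hB0 : (0 : ℝ) ≤ 2 ^ 71 * R ^ ((5 : ℝ) / 3) :=
    mul_nonneg (pow_nonneg (by norm_num) 71) (Real.rpow_nonneg hR0 _)
  have h3 := pow_le_pow_left₀ hB0 hle 3
  have e : (2 ^ 71 * R ^ ((5 : ℝ) / 3)) ^ 3 = 2 ^ 213 * R ^ 5 := by
    rw [mul_pow, ← pow_mul, ← Real.rpow_natCast (R ^ ((5 : ℝ) / 3)) 3, ← Real.rpow_mul hR0,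
      show ((5 : ℝ) / 3) * ((3 : ℕ) : ℝ) = ((5 : ℕ) : ℝ) by push_cast; norm_num, Real.rpow_natCast]
  rw [e] at h3
  exact absurd (lt_of_le_of_lt h3 hcubeR) (lt_irrefl _)

/-! ## The dictionary: a depth bound `c ≪ q^{2+δ}` gives abc on the pencil -/

/-- **Depth ⇒ abc on the square pencil.**  If for every `δ > 0` there is `C > 0` with
`r² < C · q^{2+δ}` for all members `2^l + q = r²` (`q` odd) of the pencil, then abc holds on the pencil
(`l ≥ 1`, `q`, `r` squarefree): given `ε`, use `δ = 2ε`; then `r < √C q^{1+ε}` and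
`r² < √C q^{1+ε} r ≤ √C (qr)^{1+ε} ≤ √C rad^{1+ε}`.  (The hypothesis is Ridout's theorem for `√2` and
`2`-power denominators in disguise; it is NOT proved here.) [folklore] -/
theorem squarePencil_abc_of_depth
    (hdepth : ∀ δ : ℝ, 0 < δ → ∃ C : ℝ, 0 < C ∧ ∀ l q r : ℕ, Odd q → 2 ^ l + q = r ^ 2 →
      (r : ℝ) ^ 2 < C * (q : ℝ) ^ (2 + δ)) :
    ∀ ε : ℝ, 0 < ε → ∃ C : ℝ, 0 < C ∧ ∀ l q r : ℕ, 1 ≤ l → Odd q → Squarefree q → Squarefree r →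
      2 ^ l + q = r ^ 2 →
        (r : ℝ) ^ 2 < C * ((rad (2 ^ l) q (r ^ 2) : ℕ) : ℝ) ^ (1 + ε) := by
  intro ε hε
  obtain ⟨C, hC, hCb⟩ := hdepth (2 * ε) (by linarith)
  refine ⟨Real.sqrt C, Real.sqrt_pos.mpr hC, ?_⟩
  intro l q r hl hq hsq hsr he
  have hq1 : (1 : ℝ) ≤ q := by exact_mod_cast hq.pos
  have hq0 : (0 : ℝ) ≤ q := by linarith
  have hr1 : (1 : ℝ) ≤ r := by
    have : 0 < r := by
      rcases Nat.eq_zero_or_pos r with h0 | h0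
      · subst h0; simp at he
      · exact h0
    exact_mod_cast this
  have hr0 : (0 : ℝ) ≤ r := by linarith
  have hb := hCb l q r hq he
  -- `r < √C · q^{1+ε}`
  have hsq' : (Real.sqrt C * (q : ℝ) ^ (1 + ε)) ^ 2 = C * (q : ℝ) ^ (2 + 2 * ε) := by
    rw [mul_pow, Real.sq_sqrt hC.le, ← Real.rpow_natCast ((q : ℝ) ^ (1 + ε)) 2,
      ← Real.rpow_mul hq0, show (1 + ε) * ((2 : ℕ) : ℝ) = 2 + 2 * ε by push_cast; ring]
  have hrlt : (r : ℝ) < Real.sqrt C * (q : ℝ) ^ (1 + ε) := by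
    have h0 : 0 ≤ Real.sqrt C * (q : ℝ) ^ (1 + ε) := by positivity
    exact lt_of_pow_lt_pow_left₀ 2 h0 (by rw [hsq']; exact hb)
  -- `r ≤ r^{1+ε}`, `q r ≤ rad`
  have hrpow : (r : ℝ) ≤ (r : ℝ) ^ (1 + ε) :=
    Real.self_le_rpow_of_one_le hr1 (by linarith)
  have hrad : (2 : ℝ) * q * r ≤ ((rad (2 ^ l) q (r ^ 2) : ℕ) : ℝ) := by
    exact_mod_cast squarePencil_two_mul_le_rad hl hq hsq hsr he
  have hqr_le : (q : ℝ) * r ≤ ((rad (2 ^ l) q (r ^ 2) : ℕ) : ℝ) := by nlinarith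
  have hqr0 : (0 : ℝ) ≤ (q : ℝ) * r := by positivity
  calc (r : ℝ) ^ 2 = (r : ℝ) * r := by ring
    _ ≤ (r : ℝ) * (r : ℝ) ^ (1 + ε) := mul_le_mul_of_nonneg_left hrpow hr0
    _ < (Real.sqrt C * (q : ℝ) ^ (1 + ε)) * (r : ℝ) ^ (1 + ε) :=
        mul_lt_mul_of_pos_right hrlt (Real.rpow_pos_of_pos (by linarith) _)
    _ = Real.sqrt C * (((q : ℝ) * r) ^ (1 + ε)) := by rw [Real.mul_rpow hq0 hr0]; ring
    _ ≤ Real.sqrt C * ((rad (2 ^ l) q (r ^ 2) : ℕ) : ℝ) ^ (1 + ε) :=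
        mul_le_mul_of_nonneg_left (Real.rpow_le_rpow hqr0 hqr_le (by linarith)) (Real.sqrt_nonneg C)

end Summit.ABC.ABC.Theorems
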